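import Literature.MathematicalPhysics.QuantumFieldTheory.Balaban1983to89.Beta.DyadicShell
import Literature.MathematicalPhysics.QuantumFieldTheory.Balaban1983to89.Beta.AveragingContours

/-!
# `BalabanUV.Beta.FP.DecimationCells` — road «FP» for binder row D1, row N7/H3-BOOK (b3′), part 1: THE BLOCKS OF SIDE `N` TILING `ℤ⁴`
# (the cell set of a finite set of coarse points, block regrouping of sums, sup-norm geometry of the blocks)

HONEST DEPENDENCY (page 1, mandatory): continuum YM on T⁴ ⇐ BetaPertH ∧ nine spine estimates (0/9 proved); BetaPertH ⇐ (D1) ∧ (D4) ∧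
CAP+tail; G-an2-4 gates asym, D1 and NE2/3/4.  HONEST FRAMING (cell contract, verbatim): «discharging `BetaPertH` makes Bałaban's UV
stability UNCONDITIONAL — a real constructive-QFT result; it is NOT the continuum limit and NOT the Clay problem.»  THIS MODULE is elementary
[folklore] lattice combinatorics on `ℤ⁴` (finite sets and sums only); it asserts nothing about Bałaban's objects, cites nothing, mints no `Prop`
fact; ONE data `def` (`cells`, the union of the blocks `N•v + {0,…,N−1}⁴` over a `Finset` of coarse points — a `Finset` abbreviation).  0 `sorry`.
Consumer: `FP/DecimationTail` (the N-uniform decimation ∕ Riemann lemma of road FP's horizontal route, owner ruling R-FP-15, `LEAVES-FP.md` row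
N7/H3-BOOK (b); FINDING F-d1leaf05g8-1).  NOT hbook, NOT hasym, NOT D1, NOT BetaPertH, NOT continuum, NOT Clay.

ABSOLUTE RULE (cell charter, verbatim): «No internally-minted statement may enter as a cited fact. Every hypothesis is either kernel-proved in this
package or a verbatim quotation of a PUBLISHED theorem with page reference. The manuscript(s) under audit are NOT citable for their own disputed
steps — they are the thing under adjudication; programme-internal (2001/route/tribunal) claims are never citable.»

WHAT IS HERE (over an2's `AffineAveraging.blockSum`∕`toSite` and node 5's `AveragingContours.blk`∕`off`∕`blk_add_off`∕`blk_block`, BY NAME).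
* §1 `cells N V := (V ×ˢ {0,…,N−1}⁴).image (v, b) ↦ N•v + b`; `off_block`, `block_injOn`, **`mem_cells_iff`** (`z ∈ cells N V ↔ blk N z ∈ V`),
  **`sum_blockSum_eq_sum_cells`** (`Σ_{v ∈ V} blockSum N F v = Σ_{z ∈ cells N V} F z`) — `N ≥ 1`.
* §2 sup-norm geometry (`N ≥ 1`): `lt_supNorm_of_blk` (anchor `‖blk N z‖∞ ≥ 2` ⇒ `N < ‖z‖∞`), `supNorm_lt_of_blk` (anchor `‖blk N z‖∞ ≤ R` ⇒ `‖z‖∞ < N(R+1)`),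
  `two_le_supNorm_blk` (`2N ≤ ‖z‖∞` ⇒ `2 ≤ ‖blk N z‖∞`), `supNorm_blk_le` (`‖z‖∞ ≤ N·R` ⇒ `‖blk N z‖∞ ≤ R`), `mul_supNorm_le_of_near`
  (`|x_i − N v_i| ≤ N` for all `i` ⇒ `N·‖v‖∞ ≤ ‖x‖∞ + N`).
Provenance: D1 formalisation swarm, unit b2b-balaban-beta-d1-formalise-leaf-05 gen 8 (prover-b2b-balaban-beta-d1-formalise-leaf-05-g8-0), 2026-08-20.
-/

noncomputable section

namespace Summit.QuantumFields.BalabanUV.Beta.FP.DecimationCells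

open Finset
open Literature.Probability.LatticeModels (box mem_box card_box annulus mem_annulus)
open Literature.MathematicalPhysics.QuantumFieldTheory.Balaban1983to89.Beta
open Literature.MathematicalPhysics.QuantumFieldTheory.Balaban1983to89.Beta.DyadicShell (Pt supNorm supNorm_le_iff natAbs_le_supNorm
  exists_eq_supNorm mem_box_iff not_mem_box_iff mem_annulus_iff)
open AffineAveraging (toSite blockSum)
open AveragingContours (blk off off_mem_box blk_add_off blk_block)

/-! ## §1 The blocks of side `N`: tiling of `ℤ⁴`, the cell set of a finite set of coarse points -/

/-- [our object] The union of the blocks `N•v + {0,…,N−1}⁴` over `v ∈ V` (a `Finset` of `ℤ⁴`). -/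
def cells (N : ℕ) (V : Finset Pt) : Finset Pt :=
  (V ×ˢ AffineAveraging.box 4 N).image fun p => (N : ℤ) • p.1 + toSite p.2

/-- [folklore] Coordinates of a block point: `(N•v + b)_i = N·v_i + b_i`. -/
theorem block_apply (N : ℕ) (v : Pt) (b : Fin 4 → ℕ) (i : Fin 4) :
    ((N : ℤ) • v + toSite b) i = (N : ℤ) * v i + (b i : ℤ) := by
  simp [toSite, Pi.add_apply]

/-- [folklore] The offset of a block point is its box coordinate (`N ≥ 1`). -/
theorem off_block {N : ℕ} (hN : 1 ≤ N) (v : Pt) {b : Fin 4 → ℕ} (hb : b ∈ AffineAveraging.box 4 N) :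
    off N ((N : ℤ) • v + toSite b) = b := by
  have h := blk_add_off hN ((N : ℤ) • v + toSite b)
  rw [blk_block v hb] at h
  have h' : toSite (off N ((N : ℤ) • v + toSite b)) = toSite b := add_left_cancel h
  funext i
  have := congrFun h' i
  simpa [toSite] using this

/-- [folklore] The block map `(v, b) ↦ N•v + b` is injective on `V × box` (`N ≥ 1`). -/
theorem block_injOn {N : ℕ} (hN : 1 ≤ N) (V : Finset Pt) :
    Set.InjOn (fun p : Pt × (Fin 4 → ℕ) => (N : ℤ) • p.1 + toSite p.2) (↑(V ×ˢ AffineAveraging.box 4 N) : Set (Pt × (Fin 4 → ℕ))) := by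
  intro p hp q hq hpq
  simp only [Finset.coe_product, Set.mem_prod, Finset.mem_coe] at hp hq
  have h1 : p.1 = q.1 := by
    have := congrArg (blk N) hpq
    simpa only [blk_block p.1 hp.2, blk_block q.1 hq.2] using this
  have h2 : p.2 = q.2 := by
    have := congrArg (off N) hpq
    simpa only [off_block hN p.1 hp.2, off_block hN q.1 hq.2] using this
  exact Prod.ext h1 h2

/-- [folklore] Membership in the cell set: `z ∈ cells N V ↔ blk N z ∈ V` (`N ≥ 1`). -/
theorem mem_cells_iff {N : ℕ} (hN : 1 ≤ N) {V : Finset Pt} {z : Pt} : z ∈ cells N V ↔ blk N z ∈ V := by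
  constructor
  · intro hz
    obtain ⟨p, hp, rfl⟩ := Finset.mem_image.mp hz
    rw [Finset.mem_product] at hp
    simpa only [blk_block p.1 hp.2] using hp.1
  · intro hz
    refine Finset.mem_image.mpr ⟨(blk N z, off N z), Finset.mem_product.mpr ⟨hz, off_mem_box hN z⟩, ?_⟩
    exact blk_add_off hN z

/-- [folklore] **BLOCK REGROUPING**: `Σ_{v ∈ V} blockSum N F v = Σ_{z ∈ cells N V} F z` (`N ≥ 1`). -/
theorem sum_blockSum_eq_sum_cells {N : ℕ} (hN : 1 ≤ N) (F : Pt → ℝ) (V : Finset Pt) :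
    ∑ v ∈ V, blockSum N F v = ∑ z ∈ cells N V, F z := by
  unfold cells
  rw [Finset.sum_image (block_injOn hN V), Finset.sum_product]
  rfl

/-! ## §2 Sup-norm geometry of the blocks -/

/-- [folklore] A coordinate bound from below gives a sup-norm bound from below: `(n : ℤ) < |z i| ⇒ n < ‖z‖∞`. -/
theorem lt_supNorm_of_lt_natAbs {z : Pt} {n : ℕ} {i : Fin 4} (h : n < (z i).natAbs) : n < supNorm z :=
  lt_of_lt_of_le h (natAbs_le_supNorm z i)

/-- [folklore] (G1) A block anchored at `‖v‖∞ ≥ 2` lies outside the ball of radius `N`: `blk N z = v`, `2 ≤ ‖v‖∞` ⇒ `N < ‖z‖∞` (`N ≥ 1`). -/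
theorem lt_supNorm_of_blk {N : ℕ} (hN : 1 ≤ N) {z : Pt} (hv : 2 ≤ supNorm (blk N z)) : N < supNorm z := by
  obtain ⟨i, hi⟩ := exists_eq_supNorm (blk N z)
  have hN0 : (0 : ℤ) < N := by exact_mod_cast hN
  have h2 : 2 ≤ (blk N z i).natAbs := by rw [hi]; exact hv
  have hdiv : blk N z i = z i / (N : ℤ) := rfl
  refine lt_supNorm_of_lt_natAbs (i := i) ?_
  have hzi := Int.mul_ediv_add_emod (z i) (N : ℤ)
  have hm0 := Int.emod_nonneg (z i) hN0.ne'
  have hm1 := Int.emod_lt_of_pos (z i) hN0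
  rw [← hdiv] at hzi
  -- case on the sign of the block coordinate
  rcases le_or_gt 0 (blk N z i) with hq | hq
  · have hq2 : (2 : ℤ) ≤ blk N z i := by
      have : ((blk N z i).natAbs : ℤ) = blk N z i := Int.natAbs_of_nonneg hq
      omega
    have : (N : ℤ) < z i := by nlinarith
    omega
  · have hq2 : blk N z i ≤ -2 := by
      have : ((blk N z i).natAbs : ℤ) = -blk N z i := Int.ofNat_natAbs_of_nonpos hq.le
      omega
    have : z i < -(N : ℤ) := by nlinarith
    omega

/-- [folklore] (G2) A block anchored at `‖v‖∞ ≤ R` lies inside the ball of radius `N·(R+1) − 1`: `blk N z = v`, `‖v‖∞ ≤ R` ⇒ `‖z‖∞ < N·(R+1)` (`N ≥ 1`). -/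
theorem supNorm_lt_of_blk {N : ℕ} (hN : 1 ≤ N) {z : Pt} {R : ℕ} (hv : supNorm (blk N z) ≤ R) : supNorm z < N * (R + 1) := by
  have hN0 : (0 : ℤ) < N := by exact_mod_cast hN
  have hall := (supNorm_le_iff.mp hv)
  -- every coordinate of `z` has absolute value `< N (R+1)`
  have hcoord : ∀ i, (z i).natAbs < N * (R + 1) := by
    intro i
    have hq := hall i
    have hdiv : blk N z i = z i / (N : ℤ) := rfl
    have hzi := Int.mul_ediv_add_emod (z i) (N : ℤ)
    have hm0 := Int.emod_nonneg (z i) hN0.ne'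
    have hm1 := Int.emod_lt_of_pos (z i) hN0
    rw [← hdiv] at hzi
    have hqabs : -(R : ℤ) ≤ blk N z i ∧ blk N z i ≤ R := by
      have := (DyadicShell.natAbs_le_iff_mem (z := blk N z i) (L := R)).mp hq
      exact this
    have hup : z i < (N : ℤ) * (R + 1) := by nlinarith
    have hlo : -((N : ℤ) * (R + 1)) < z i := by nlinarith
    have : ((z i).natAbs : ℤ) < (N : ℤ) * (R + 1) := by
      rw [Int.natCast_natAbs]; exact abs_lt.mpr ⟨hlo, hup⟩
    exact_mod_cast this
  obtain ⟨i, hi⟩ := exists_eq_supNorm z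
  rw [← hi]; exact hcoord i

/-- [folklore] (G3) Far points have far anchors: `2N ≤ ‖z‖∞` ⇒ `2 ≤ ‖blk N z‖∞` (`N ≥ 1`). -/
theorem two_le_supNorm_blk {N : ℕ} (hN : 1 ≤ N) {z : Pt} (hz : 2 * N ≤ supNorm z) : 2 ≤ supNorm (blk N z) := by
  have hN0 : (0 : ℤ) < N := by exact_mod_cast hN
  obtain ⟨i, hi⟩ := exists_eq_supNorm z
  have hzi2 : 2 * N ≤ (z i).natAbs := by rw [hi]; exact hz
  refine le_trans ?_ (natAbs_le_supNorm (blk N z) i)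
  have hdiv : blk N z i = z i / (N : ℤ) := rfl
  rcases le_or_gt 0 (z i) with h0 | h0
  · have hz' : (2 : ℤ) * N ≤ z i := by
      have : ((z i).natAbs : ℤ) = z i := Int.natAbs_of_nonneg h0
      omega
    have hq : (2 : ℤ) ≤ z i / (N : ℤ) := by
      rw [Int.le_ediv_iff_mul_le hN0]; linarith
    have : ((blk N z i).natAbs : ℤ) ≥ 2 := by
      rw [hdiv, Int.natAbs_of_nonneg (by positivity)]; exact hq
    exact_mod_cast this
  · have hz' : z i ≤ -(2 * (N : ℤ)) := by
      have : ((z i).natAbs : ℤ) = -z i := Int.ofNat_natAbs_of_nonpos h0.le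
      omega
    have hq : z i / (N : ℤ) ≤ -2 := by
      have h1 : z i / (N : ℤ) < -1 := by
        rw [Int.ediv_lt_iff_lt_mul hN0]; linarith
      have h2 : z i / (N : ℤ) ≤ (-(2 * (N : ℤ))) / (N : ℤ) := Int.ediv_le_ediv hN0 hz'
      have h3 : (-(2 * (N : ℤ))) / (N : ℤ) = -2 := by
        rw [show -(2 * (N : ℤ)) = (-2) * (N : ℤ) by ring, Int.mul_ediv_cancel _ hN0.ne']
      omega
    have : ((blk N z i).natAbs : ℤ) ≥ 2 := by
      rw [hdiv, Int.ofNat_natAbs_of_nonpos (by omega)]; omega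
    exact_mod_cast this

/-- [folklore] (G4) Near points have near anchors: `‖z‖∞ ≤ N·R` ⇒ `‖blk N z‖∞ ≤ R` (`N ≥ 1`). -/
theorem supNorm_blk_le {N : ℕ} (hN : 1 ≤ N) {z : Pt} {R : ℕ} (hz : supNorm z ≤ N * R) : supNorm (blk N z) ≤ R := by
  have hN0 : (0 : ℤ) < N := by exact_mod_cast hN
  rw [supNorm_le_iff]
  intro i
  have hzi : (z i).natAbs ≤ N * R := le_trans (natAbs_le_supNorm z i) hz
  have hb := (DyadicShell.natAbs_le_iff_mem (z := z i) (L := N * R)).mp hzi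
  rw [DyadicShell.natAbs_le_iff_mem]
  have hdiv : blk N z i = z i / (N : ℤ) := rfl
  push_cast at hb
  constructor
  · rw [hdiv]
    have h2 : (-((N : ℤ) * R)) / (N : ℤ) ≤ z i / (N : ℤ) := Int.ediv_le_ediv hN0 (by linarith [hb.1])
    have h3 : (-((N : ℤ) * R)) / (N : ℤ) = -(R : ℤ) := by
      rw [show -((N : ℤ) * R) = (-(R : ℤ)) * (N : ℤ) by ring, Int.mul_ediv_cancel _ hN0.ne']
    omega
  · rw [hdiv]
    have h2 : z i / (N : ℤ) ≤ ((N : ℤ) * R) / (N : ℤ) := Int.ediv_le_ediv hN0 hb.2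
    have h3 : ((N : ℤ) * R) / (N : ℤ) = (R : ℤ) := by
      rw [show (N : ℤ) * R = (R : ℤ) * (N : ℤ) by ring, Int.mul_ediv_cancel _ hN0.ne']
    omega

/-- [folklore] (G5) Points within sup-distance `N` of the anchor `N•v`, `‖v‖∞ = m ≥ 1`, have `‖x‖∞ ≥ N·(m − 1)`: stated as
`N·‖v‖∞ ≤ ‖x‖∞ + N`. -/
theorem mul_supNorm_le_of_near {N : ℕ} {v x : Pt} (hx : ∀ i, |x i - (N : ℤ) * v i| ≤ (N : ℤ)) : N * supNorm v ≤ supNorm x + N := by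
  obtain ⟨i, hi⟩ := exists_eq_supNorm v
  have h := hx i
  have h1 : (N : ℤ) * |v i| ≤ |x i| + N := by
    have := abs_sub_abs_le_abs_sub ((N : ℤ) * v i) (x i)
    rw [abs_sub_comm] at this
    rw [abs_mul, Nat.abs_cast] at this
    linarith
  have h2 : ((N * supNorm v : ℕ) : ℤ) ≤ ((supNorm x + N : ℕ) : ℤ) := by
    push_cast
    rw [← hi, Int.natCast_natAbs]
    have : ((x i).natAbs : ℤ) ≤ (supNorm x : ℤ) := by exact_mod_cast natAbs_le_supNorm x i
    rw [Int.natCast_natAbs] at this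
    linarith
  exact_mod_cast h2

end Summit.QuantumFields.BalabanUV.Beta.FP.DecimationCells

end
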